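import Literature.AnabelianGeometry.SemiGraphs.TreeSystemLevelImageTransport
import Literature.AnabelianGeometry.SemiGraphs.TemperedConfinedOfTopCyclicTree
import HarnessLib

/-!
# [SemiAnbd] Thm 3.7 (iii) / Cor 3.9 (R3c) for TOPOLOGICALLY CYCLIC edge groups on an ARBITRARY `𝔾`:
# the level geodesics of a compatible fixed pair BACKTRACK IN THE BASE at every interior vertex, hence
# lie over ONE base edge (proof-only)

Mochizuki, *Semi-graphs of anabelioids*, Publ. RIMS **42** (2006), §3 Theorem 3.7 (iii), proof p. 41,
third paragraph, with the author's *Comments* (2020) (6)(b); Corollary 3.9, proof p. 43 l. 13 (the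
cell's step (R3c), FACT-LIST rows F-2772 `EdgeLikeCentralizerAt` / F-2773 `EdgeLikeCentralizer`)
[cite: MochizukiSemiAnbd2006, Thm 3.7(iii) p.41].

PROOF-ONLY (cell abc-iut, block F, seat abc-iut-f-175 gen 4; geometric lemma layer of «CONFINED@TOP-CYCLIC»;
no definition, no named fact).  At the canonical tower of a countable `𝒢` satisfying the hypotheses of
Thm. 3.7 ALL of whose edge groups are topologically cyclic — NO hypothesis on the underlying semi-graph
`𝔾` (cycles, loops, infinitely-branching cores, infinite valence all allowed) — and for EVERY subgroup
`C ≠ 1` of `π₁^temp(𝒢)` and every compatible `C`-fixed pair of vertex systems `(x, x')`: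
* `branchMap_eq_of_flanking_of_topCyclic` — on every level path `[x_k, x'_k]` the two branch-points
  flanking an interior vertex-point lie over the SAME base branch (the base walk BACKTRACKS);
* `edgeMap_eq_of_mem_support_of_topCyclic` — hence ALL branch-points of `[x_k, x'_k]` lie over ONE base
  edge (the pair is confined over one edge; cf. abc-iut-f-172's `mem_verticial_of_centralizer_of_confined`
  / `exists_two_baseEdges_of_centralizer_not_mem`, which turn this into the (R3c) class statements).
Proof of the first: were the flanking branches `β`, `β'` of `z` over base branches `b ≠ b'` at `w`,
abc-iut-w6-d062's estrangement in depth (`eventually_not_fixed_pair_of_ne_base_pair`) forbids, from some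
level `K` on, ANY vertex over `w` with `c`-fixed branches over both; at a level `n ≥ k, K` the geodesic
`[x_n, x'_n]` maps onto a walk of `𝔾̃_k` through `β, z, β'`, whose last-`β` / first-`β'` window lifts to
vertices `ẑ, ẑ'` over `z` ON `[x_n, x'_n]` carrying lifts `β̂` of `β`, `β̂'` of `β'`, joined by a `C`-fixed
sub-path with CLOSED image at `z` in the TREE `𝔾̃_k`; abc-iut-f-172 gen 7's cross-level transport
`exists_fixed_branch_of_sameImage_path` (first returns come back through the `𝔾̃_k`-branch they left by;
then gen 3's brick (A), switch-freeness of cyclic edge stabilisers) carries `β̂'` back to `ẑ` — a vertex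
over `w` with `c`-fixed branches over `b` and `b'` at level `n ≥ K`: contradiction.  (Gen 3's path
transport never needed the BASE to be a tree: the lower LEVEL tree does the job.)

Honest framing: the ∀-closures F-2773 / F-1732 are NOT claimed; nothing here bears on [IUTchIII]
Cor. 3.12; typed ≠ proved elsewhere.
-/

namespace Literature.AnabelianGeometry.SemiGraphs

open CategoryTheory Topology

universe u

namespace SemiGraph

variable {G G' : SemiGraph.{u}} (Ψ : G ⟶ G')

/-- A node mapped to a branch-point by a morphism is a branch-point over it. [cite: MochizukiSemiAnbd2006, §1 p.11] -/
theorem exists_branch_of_map_eq_inr_inr {y : G.Node} {β : G'.Branch}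
    (h : Sum.map Ψ.vertexMap (Sum.map Ψ.edgeMap Ψ.branchMap) y = Sum.inr (Sum.inr β)) :
    ∃ b : G.Branch, y = Sum.inr (Sum.inr b) ∧ Ψ.branchMap b = β := by
  rcases y with v | e | b <;> [simp at h; simp at h; exact ⟨b, rfl, by simpa using h⟩]

/-- A node mapped to a vertex-point by a morphism is a vertex-point over it. [cite: MochizukiSemiAnbd2006, §1 p.11] -/
theorem exists_vertex_of_map_eq_inl {y : G.Node} {z : G'.Vertex}
    (h : Sum.map Ψ.vertexMap (Sum.map Ψ.edgeMap Ψ.branchMap) y = Sum.inl z) :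
    ∃ v : G.Vertex, y = Sum.inl v ∧ Ψ.vertexMap v = z := by
  rcases y with v | e | b <;> [exact ⟨v, rfl, by simpa using h⟩; simp at h; simp at h]

/-- A branch-point adjacent to the point of the vertex `z` abuts to `z`. [cite: MochizukiSemiAnbd2006, §1 pp.11-12] -/
theorem abuts_of_adj_inl {z : G.Vertex} {β : G.Branch}
    (h : G.subdivision.Adj (Sum.inl z) (Sum.inr (Sum.inr β))) : G.abuts β = some z := by
  obtain ⟨b, hb, hbb⟩ := (G.subdivision_adj_inl_iff z _).mp h
  have : b = β := by simpa using hbb.symm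
  exact this ▸ hb

end SemiGraph

namespace ProfiniteSemiGraph

variable (𝒢 : ProfiniteSemiGraph.{u}) (h37 : 𝒢.Thm37Hypotheses)

section TopCyclic

variable (hcyc : ∀ e : 𝒢.graph.Edge, ∃ t₀ : 𝒢.Ge e, (Subgroup.zpowers t₀).topologicalClosure = ⊤)
  (C : Subgroup (𝒢.temperedPiChart h37.toProp36Hypotheses).G) (hC : C ≠ ⊥)
  (x x' : ∀ j, ((𝒢.galoisLevelData h37.toProp36Hypotheses).tree j).Vertex)
  (hx : ∀ ⦃i j : ℕ⦄ (hij : i ≤ j),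
    ((𝒢.galoisLevelData h37.toProp36Hypotheses).treeTrans hij).vertexMap (x j) = x i)
  (hx' : ∀ ⦃i j : ℕ⦄ (hij : i ≤ j),
    ((𝒢.galoisLevelData h37.toProp36Hypotheses).treeTrans hij).vertexMap (x' j) = x' i)
  (hfx : ∀ g ∈ C, ∀ j,
    ((𝒢.galoisLevelData h37.toProp36Hypotheses).treeAct h37.toProp36Hypotheses.isCountable j g).hom.vertexMap (x j) = x j)
  (hfx' : ∀ g ∈ C, ∀ j,
    ((𝒢.galoisLevelData h37.toProp36Hypotheses).treeAct h37.toProp36Hypotheses.isCountable j g).hom.vertexMap (x' j) = x' j)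

include hcyc hC hx hx' hfx hfx'

/-- **BASE BACKTRACKING** (see the file header): all edge groups topologically cyclic, ANY `𝔾`, `C ≠ 1` any
subgroup, `(x, x')` a compatible `C`-fixed pair; on a level path `p = [x_k, x'_k]`, if the nodes `i`,
`i + 1`, `i + 2` of `p` are a branch-point `β`, a vertex-point `z` and a branch-point `β'`, then `β` and
`β'` lie over the SAME branch of `𝔾`. [cite: MochizukiSemiAnbd2006, Thm 3.7(iii) p.41] -/
theorem branchMap_eq_of_flanking_of_topCyclic
    (k : ℕ)
    (p : ((𝒢.galoisLevelData h37.toProp36Hypotheses).tree k).subdivision.Walk (Sum.inl (x k)) (Sum.inl (x' k)))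
    (hp : p.IsPath) {i : ℕ} {β β' : ((𝒢.galoisLevelData h37.toProp36Hypotheses).tree k).Branch}
    {z : ((𝒢.galoisLevelData h37.toProp36Hypotheses).tree k).Vertex}
    (hβ : p.getVert i = Sum.inr (Sum.inr β)) (hz : p.getVert (i + 1) = Sum.inl z)
    (hβ' : p.getVert (i + 2) = Sum.inr (Sum.inr β')) :
    ((𝒢.galoisLevelData h37.toProp36Hypotheses).treeProj k).branchMap β =
      ((𝒢.galoisLevelData h37.toProp36Hypotheses).treeProj k).branchMap β' := by
  classical
  let D := 𝒢.galoisLevelData h37.toProp36Hypotheses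
  let hc := h37.toProp36Hypotheses.isCountable
  by_contra hne
  -- the three nodes lie on `p`
  have hi2 : i + 2 ≤ p.length := by
    by_contra h
    have h1 : p.getVert (i + 2) = Sum.inl (x' k) := p.getVert_of_length_le (by omega)
    rw [hβ'] at h1
    simp at h1
  have hββ' : β ≠ β' := by
    intro h
    have h0 : p.getVert i = p.getVert (i + 2) := by rw [hβ, hβ', h]
    have := hp.getVert_injOn (by simp; omega) (by simp; omega) h0
    omega
  -- `β`, `β'` abut `z`; base data at `w`
  have hβz : (D.tree k).abuts β = some z := by
    have h := p.adj_getVert_succ (i := i) (by omega)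
    rw [hβ, hz] at h
    exact SemiGraph.abuts_of_adj_inl h.symm
  have hβ'z : (D.tree k).abuts β' = some z := by
    have h := p.adj_getVert_succ (i := i + 1) (by omega)
    rw [hz, show i + 1 + 1 = i + 2 by omega, hβ'] at h
    exact SemiGraph.abuts_of_adj_inl h
  set w := (D.treeProj k).vertexMap z with hw
  have hbw : 𝒢.graph.abuts ((D.treeProj k).branchMap β) = some w := by
    rw [(D.treeProj k).abuts_branchMap β z hβz]
  have hb'w : 𝒢.graph.abuts ((D.treeProj k).branchMap β') = some w := by
    rw [(D.treeProj k).abuts_branchMap β' z hβ'z]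
  -- estrangement in depth at the pair of base branches, for a non-trivial element of `C`
  obtain ⟨c, hcC, hc1⟩ : ∃ c ∈ C, c ≠ 1 := by
    by_contra h; push Not at h; exact hC ((Subgroup.eq_bot_iff_forall C).2 h)
  obtain ⟨j₀, hcj₀⟩ := 𝒢.exists_proj_ne_one h37.toProp36Hypotheses c hc1
  obtain ⟨K, -, hK⟩ := 𝒢.eventually_not_fixed_pair_of_ne_base_pair h37 c j₀ hcj₀ w hbw hb'w hne
  -- a deep level `n ≥ k, K` and its `C`-fixed geodesic `γ`
  obtain ⟨n, hkn, hKn⟩ : ∃ n, k ≤ n ∧ K ≤ n := ⟨max k K, le_max_left _ _, le_max_right _ _⟩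
  have hT := (D.isTree_tree n).isTree
  have hTk := (D.isTree_tree k).isTree
  let γ : (D.tree n).subdivision.Path (Sum.inl (x n)) (Sum.inl (x' n)) := (hT.connected _ _).some.toPath
  have hγfix : ∀ y ∈ γ.1.support, ∀ g ∈ C, SemiGraph.nodeMap (D.treeAct hc n g) y = y := by
    intro y hy g hg
    have h1 : SemiGraph.nodeMap (D.treeAct hc n g) (Sum.inl (x n)) = Sum.inl (x n) := by
      rw [SemiGraph.nodeMap_inl]; exact congrArg Sum.inl (hfx g hg n)
    have h2 : SemiGraph.nodeMap (D.treeAct hc n g) (Sum.inl (x' n)) = Sum.inl (x' n) := by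
      rw [SemiGraph.nodeMap_inl]; exact congrArg Sum.inl (hfx' g hg n)
    exact SemiGraph.nodeMap_eq_self_of_isPath hT.isAcyclic _ h1 h2 γ.1 γ.2 y hy
  have hfixE : ∀ b : (D.tree n).Branch, (Sum.inr (Sum.inr b) : (D.tree n).Node) ∈ γ.1.support →
      ∀ g ∈ C, (D.treeAct hc n g).hom.edgeMap ((D.tree n).edgeOf b) = (D.tree n).edgeOf b := by
    intro b hb g hg
    have h := hγfix _ hb g hg
    simp only [SemiGraph.nodeMap_inr_inr, Sum.inr.injEq] at h
    rw [← (D.treeAct hc n g).hom.edgeOf_branchMap b, h]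
  -- the image walk `W` of `γ` in `𝔾̃_k`, from `x_k` to `x'_k`
  let Φ : (D.tree n).subdivision →g (D.tree k).subdivision :=
    ⟨Sum.map (D.treeTrans hkn).vertexMap (Sum.map (D.treeTrans hkn).edgeMap (D.treeTrans hkn).branchMap),
      fun h => SemiGraph.subdivision_adj_map (D.treeTrans hkn) h⟩
  have e₁ : Φ (Sum.inl (x n)) = Sum.inl (x k) := by
    change Sum.inl ((D.treeTrans hkn).vertexMap (x n)) = Sum.inl (x k)
    rw [hx hkn]
  have e₂ : Φ (Sum.inl (x' n)) = Sum.inl (x' k) := by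
    change Sum.inl ((D.treeTrans hkn).vertexMap (x' n)) = Sum.inl (x' k)
    rw [hx' hkn]
  let W : (D.tree k).subdivision.Walk (Sum.inl (x k)) (Sum.inl (x' k)) := (γ.1.map Φ).copy e₁ e₂
  have hWv : ∀ j, W.getVert j = Φ (γ.1.getVert j) := fun j => by
    rw [SimpleGraph.Walk.getVert_copy, SimpleGraph.Walk.getVert_map]
  have hWv' : ∀ j, Sum.map (D.treeTrans hkn).vertexMap
      (Sum.map (D.treeTrans hkn).edgeMap (D.treeTrans hkn).branchMap) (γ.1.getVert j) = W.getVert j :=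
    fun j => by rw [hWv]; rfl
  have hWlen : W.length = γ.1.length := by
    rw [SimpleGraph.Walk.length_copy, SimpleGraph.Walk.length_map]
  -- the FIRST occurrence `t` of `β'` on `W`
  have hβ'W : (Sum.inr (Sum.inr β') : (D.tree k).Node) ∈ W.support :=
    SemiGraph.support_subset_support_of_isPath hTk.isAcyclic W p hp (hβ' ▸ p.getVert_mem_support (i + 2))
  have hext : ∃ t, W.getVert t = Sum.inr (Sum.inr β') :=
    let ⟨t, ht, _⟩ := SimpleGraph.Walk.mem_support_iff_exists_getVert.mp hβ'W; ⟨t, ht⟩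
  obtain ⟨t, ht, htmin⟩ : ∃ t, W.getVert t = Sum.inr (Sum.inr β') ∧
      ∀ t', t' < t → W.getVert t' ≠ Sum.inr (Sum.inr β') :=
    ⟨Nat.find hext, Nat.find_spec hext, fun t' h => Nat.find_min hext h⟩
  have htlen : t ≤ W.length := by
    by_contra h
    have h1 := W.getVert_of_length_le (le_of_lt (not_le.mp h))
    rw [ht] at h1
    simp at h1
  -- `β` occurs on `W` before `t`: the prefix of `p` up to `β'` passes through `β`
  have hexs : ∃ s, s ≤ t ∧ W.getVert s = Sum.inr (Sum.inr β) := by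
    let Q : (D.tree k).subdivision.Walk (Sum.inl (x k)) (Sum.inr (Sum.inr β')) := (p.take (i + 2)).copy rfl hβ'
    have hQ : Q.IsPath := by
      rw [SimpleGraph.Walk.isPath_copy]
      exact hp.take (i + 2)
    let W₀ : (D.tree k).subdivision.Walk (Sum.inl (x k)) (Sum.inr (Sum.inr β')) := (W.take t).copy rfl ht
    have hβQ : (Sum.inr (Sum.inr β) : (D.tree k).Node) ∈ Q.support := by
      refine SimpleGraph.Walk.mem_support_iff_exists_getVert.mpr ⟨i, ?_, ?_⟩
      · rw [SimpleGraph.Walk.getVert_copy, SimpleGraph.Walk.take_getVert,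
          min_eq_right (by omega : i ≤ i + 2), hβ]
      · rw [SimpleGraph.Walk.length_copy, SimpleGraph.Walk.take_length]
        exact le_min (by omega) (by omega)
    have hβW₀ : (Sum.inr (Sum.inr β) : (D.tree k).Node) ∈ W₀.support :=
      SemiGraph.support_subset_support_of_isPath hTk.isAcyclic W₀ Q hQ hβQ
    obtain ⟨s, hs, hsle⟩ := SimpleGraph.Walk.mem_support_iff_exists_getVert.mp hβW₀
    rw [SimpleGraph.Walk.getVert_copy, SimpleGraph.Walk.take_getVert] at hs
    rw [SimpleGraph.Walk.length_copy, SimpleGraph.Walk.take_length] at hsle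
    have hst : s ≤ t := le_trans hsle (min_le_left _ _)
    rw [min_eq_right hst] at hs
    exact ⟨s, hst, hs⟩
  -- the LAST occurrence `s` of `β` on `W` before `t`
  obtain ⟨s₁, hs₁t, hs₁⟩ := hexs
  obtain ⟨s, hs, hst, hsmax⟩ : ∃ s, W.getVert s = Sum.inr (Sum.inr β) ∧ s ≤ t ∧
      ∀ s', s < s' → s' ≤ t → W.getVert s' ≠ Sum.inr (Sum.inr β) :=
    ⟨Nat.findGreatest (fun s => W.getVert s = Sum.inr (Sum.inr β)) t,
      Nat.findGreatest_spec (P := fun s => W.getVert s = Sum.inr (Sum.inr β)) hs₁t hs₁,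
      Nat.findGreatest_le t, fun s' h h' => Nat.findGreatest_is_greatest h h'⟩
  have hslt : s < t := by
    refine lt_of_le_of_ne hst fun h => hββ' ?_
    rw [h, ht] at hs
    simpa using hs.symm
  -- after `s` and before `t` the walk is at the point of `z`
  have hWs1 : W.getVert (s + 1) = Sum.inl z := by
    have hadj := W.adj_getVert_succ (i := s) (by omega)
    rw [hs] at hadj
    rcases ((D.tree k).subdivision_adj_branch_iff β _).mp hadj with h | ⟨v, hv, h⟩
    · -- through the edge-point of `β`: the walk returns to `β` before reaching `β'`
      exfalso
      have hββ'n : (Sum.inr (Sum.inr β) : (D.tree k).Node) ≠ Sum.inr (Sum.inr β') := by simpa using hββ'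
      have a₁ : (D.tree k).subdivision.Adj (Sum.inr (Sum.inl ((D.tree k).edgeOf β))) (Sum.inr (Sum.inr β)) :=
        ((D.tree k).subdivision_adj_edge_iff _ _).mpr ⟨β, rfl, rfl⟩
      have a₂ : (D.tree k).subdivision.Adj (Sum.inr (Sum.inr β)) (Sum.inl z) :=
        ((D.tree k).subdivision_adj_branch_iff β _).mpr (Or.inr ⟨z, hβz, rfl⟩)
      have a₃ : (D.tree k).subdivision.Adj (Sum.inl z) (Sum.inr (Sum.inr β')) :=
        ((D.tree k).subdivision_adj_inl_iff z _).mpr ⟨β', hβ'z, rfl⟩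
      let R : (D.tree k).subdivision.Walk (Sum.inr (Sum.inl ((D.tree k).edgeOf β))) (Sum.inr (Sum.inr β')) :=
        SimpleGraph.Walk.cons a₁ (SimpleGraph.Walk.cons a₂ (SimpleGraph.Walk.cons a₃ SimpleGraph.Walk.nil))
      have hR : R.IsPath := SimpleGraph.Walk.IsPath.mk' (by simp [R, hββ'n])
      have hend : (W.drop (s + 1)).getVert (t - (s + 1)) = Sum.inr (Sum.inr β') := by
        rw [SimpleGraph.Walk.drop_getVert, show s + 1 + (t - (s + 1)) = t by omega, ht]
      let W₁ : (D.tree k).subdivision.Walk (Sum.inr (Sum.inl ((D.tree k).edgeOf β))) (Sum.inr (Sum.inr β')) :=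
        ((W.drop (s + 1)).take (t - (s + 1))).copy h hend
      have hβW₁ : (Sum.inr (Sum.inr β) : (D.tree k).Node) ∈ W₁.support :=
        SemiGraph.support_subset_support_of_isPath hTk.isAcyclic W₁ R hR (by simp [R])
      obtain ⟨m, hm, hmle⟩ := SimpleGraph.Walk.mem_support_iff_exists_getVert.mp hβW₁
      rw [SimpleGraph.Walk.getVert_copy, SimpleGraph.Walk.take_getVert, SimpleGraph.Walk.drop_getVert] at hm
      rw [SimpleGraph.Walk.length_copy, SimpleGraph.Walk.take_length] at hmle
      have hmle' : m ≤ t - (s + 1) := le_trans hmle (min_le_left _ _)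
      rw [min_eq_right hmle'] at hm
      exact hsmax (s + 1 + m) (by omega) (by omega) hm
    · rw [hβz] at hv
      rw [h, ← Option.some.inj hv]
  have hs2t : s + 2 ≤ t := by
    by_contra h
    have h1 : s + 1 = t := by omega
    rw [← h1, hWs1] at ht
    simp at ht
  have hWt1 : W.getVert (t - 1) = Sum.inl z := by
    have hadj := W.adj_getVert_succ (i := t - 1) (by omega)
    rw [show t - 1 + 1 = t by omega, ht] at hadj
    rcases ((D.tree k).subdivision_adj_branch_iff β' _).mp hadj.symm with h | ⟨v, hv, h⟩
    · -- from the edge-point of `β'`: the walk met `β'` before `t`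
      exfalso
      have hββ'n : (Sum.inr (Sum.inr β) : (D.tree k).Node) ≠ Sum.inr (Sum.inr β') := by simpa using hββ'
      have a₁ : (D.tree k).subdivision.Adj (Sum.inr (Sum.inr β)) (Sum.inl z) :=
        ((D.tree k).subdivision_adj_branch_iff β _).mpr (Or.inr ⟨z, hβz, rfl⟩)
      have a₂ : (D.tree k).subdivision.Adj (Sum.inl z) (Sum.inr (Sum.inr β')) :=
        ((D.tree k).subdivision_adj_inl_iff z _).mpr ⟨β', hβ'z, rfl⟩
      have a₃ : (D.tree k).subdivision.Adj (Sum.inr (Sum.inr β')) (Sum.inr (Sum.inl ((D.tree k).edgeOf β'))) :=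
        ((D.tree k).subdivision_adj_branch_iff β' _).mpr (Or.inl rfl)
      let R : (D.tree k).subdivision.Walk (Sum.inr (Sum.inr β)) (Sum.inr (Sum.inl ((D.tree k).edgeOf β'))) :=
        SimpleGraph.Walk.cons a₁ (SimpleGraph.Walk.cons a₂ (SimpleGraph.Walk.cons a₃ SimpleGraph.Walk.nil))
      have hR : R.IsPath := SimpleGraph.Walk.IsPath.mk' (by simp [R, hββ'n])
      have hend : (W.drop s).getVert (t - 1 - s) = Sum.inr (Sum.inl ((D.tree k).edgeOf β')) := by
        rw [SimpleGraph.Walk.drop_getVert, show s + (t - 1 - s) = t - 1 by omega, h]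
      let W₂ : (D.tree k).subdivision.Walk (Sum.inr (Sum.inr β)) (Sum.inr (Sum.inl ((D.tree k).edgeOf β'))) :=
        ((W.drop s).take (t - 1 - s)).copy hs hend
      have hβ'W₂ : (Sum.inr (Sum.inr β') : (D.tree k).Node) ∈ W₂.support :=
        SemiGraph.support_subset_support_of_isPath hTk.isAcyclic W₂ R hR (by simp [R])
      obtain ⟨m, hm, hmle⟩ := SimpleGraph.Walk.mem_support_iff_exists_getVert.mp hβ'W₂
      rw [SimpleGraph.Walk.getVert_copy, SimpleGraph.Walk.take_getVert, SimpleGraph.Walk.drop_getVert] at hm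
      rw [SimpleGraph.Walk.length_copy, SimpleGraph.Walk.take_length] at hmle
      have hmle' : m ≤ t - 1 - s := le_trans hmle (min_le_left _ _)
      rw [min_eq_right hmle'] at hm
      exact htmin (s + m) (by omega) hm
    · rw [hβ'z] at hv
      rw [h, ← Option.some.inj hv]
  -- lifts to `γ`: `βl` at `zl` over `β` at `z`, `βl'` at `zl'` over `β'` at `z`
  obtain ⟨βl, hγs, hβl⟩ := SemiGraph.exists_branch_of_map_eq_inr_inr (D.treeTrans hkn) ((hWv' s).trans hs)
  obtain ⟨zl, hγs1, hzl⟩ := SemiGraph.exists_vertex_of_map_eq_inl (D.treeTrans hkn) ((hWv' (s + 1)).trans hWs1)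
  obtain ⟨zl', hγt1, hzl'⟩ := SemiGraph.exists_vertex_of_map_eq_inl (D.treeTrans hkn) ((hWv' (t - 1)).trans hWt1)
  obtain ⟨βl', hγt, hβl'⟩ := SemiGraph.exists_branch_of_map_eq_inr_inr (D.treeTrans hkn) ((hWv' t).trans ht)
  have hβlzl : (D.tree n).abuts βl = some zl := by
    have h := γ.1.adj_getVert_succ (i := s) (by omega)
    rw [hγs, hγs1] at h
    exact SemiGraph.abuts_of_adj_inl h.symm
  have hβl'zl' : (D.tree n).abuts βl' = some zl' := by
    have h := γ.1.adj_getVert_succ (i := t - 1) (by omega)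
    rw [show t - 1 + 1 = t by omega, hγt1, hγt] at h
    exact SemiGraph.abuts_of_adj_inl h
  -- the `C`-fixed sub-path `E` of `γ` from `zl` to `zl'`, with closed image at `z`
  have hEend : (γ.1.drop (s + 1)).getVert (t - 1 - (s + 1)) = Sum.inl zl' := by
    rw [SimpleGraph.Walk.drop_getVert, show s + 1 + (t - 1 - (s + 1)) = t - 1 by omega, hγt1]
  let E : (D.tree n).subdivision.Walk (Sum.inl zl) (Sum.inl zl') :=
    ((γ.1.drop (s + 1)).take (t - 1 - (s + 1))).copy hγs1 hEend
  have hEpath : E.IsPath := by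
    rw [SimpleGraph.Walk.isPath_copy]
    exact (γ.2.drop _).take _
  have hEfix : ∀ y ∈ E.support, ∀ g ∈ C, SemiGraph.nodeMap (D.treeAct hc n g) y = y := by
    intro y hy
    rw [SimpleGraph.Walk.support_copy, SimpleGraph.Walk.support_take] at hy
    have hy' := List.take_subset _ _ hy
    rw [SimpleGraph.Walk.drop_support_eq_support_drop_min] at hy'
    exact hγfix y (List.drop_subset _ _ hy')
  -- cross-level transport (abc-iut-f-172 gen 7): `βl'` back to `zl` along `E`, same image in `𝔾̃_k`
  obtain ⟨P₀⟩ := GaloisLevelData.nonempty_pointSeq h37.toProp36Hypotheses w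
  have hβl'mem : (Sum.inr (Sum.inr βl') : (D.tree n).Node) ∈ γ.1.support := hγt ▸ γ.1.getVert_mem_support t
  have hβlmem : (Sum.inr (Sum.inr βl) : (D.tree n).Node) ∈ γ.1.support := hγs ▸ γ.1.getVert_mem_support s
  have hzlw : (D.treeProj n).vertexMap zl = w := by
    rw [D.treeProj_vertexMap_eq_treeProj_treeTrans hkn, hzl]
  obtain ⟨α, hαzl, hαb, hαfix⟩ := D.exists_fixed_branch_of_sameImage_path hc hkn C hcyc P₀ hzlw
    (hzl.trans hzl'.symm) E hEpath hEfix βl' hβl'zl' (hfixE βl' hβl'mem)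
  -- base bookkeeping: `βl` over `b`, `α` over `b'`, both at `zl` over `w`, at level `n ≥ K`
  obtain ⟨P, hP⟩ := P₀.exists_pointSeq_vertex_eq_of_treeProj n zl hzlw
  refine hK n hKn P βl α ?_ ?_ ?_ ?_ (hfixE βl hβlmem c hcC) (hαfix c hcC)
  · rw [D.treeProj_branchMap_eq_treeProj_treeTrans hkn, hβl]
  · rw [D.treeProj_branchMap_eq_treeProj_treeTrans hkn, hαb, hβl']
  · rw [hP]; exact hβlzl
  · rw [hP]; exact hαzl

/-- **CONFINED: one base edge** (see the file header): all edge groups topologically cyclic, ANY `𝔾`,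
`C ≠ 1` any subgroup, `(x, x')` a compatible `C`-fixed pair; any two branch-points on a level path
`[x_k, x'_k]` lie over the SAME edge of `𝔾` (induction along the path: consecutive branch-points flank
either an edge-point — same edge — or a vertex-point — same base branch by
`branchMap_eq_of_flanking_of_topCyclic`). [cite: MochizukiSemiAnbd2006, Thm 3.7(iii) p.41] -/
theorem edgeMap_eq_of_mem_support_of_topCyclic
    (k : ℕ)
    (p : ((𝒢.galoisLevelData h37.toProp36Hypotheses).tree k).subdivision.Walk (Sum.inl (x k)) (Sum.inl (x' k)))
    (hp : p.IsPath) {β₁ β₂ : ((𝒢.galoisLevelData h37.toProp36Hypotheses).tree k).Branch}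
    (hβ₁ : (Sum.inr (Sum.inr β₁) : ((𝒢.galoisLevelData h37.toProp36Hypotheses).tree k).Node) ∈ p.support)
    (hβ₂ : (Sum.inr (Sum.inr β₂) : ((𝒢.galoisLevelData h37.toProp36Hypotheses).tree k).Node) ∈ p.support) :
    ((𝒢.galoisLevelData h37.toProp36Hypotheses).treeProj k).edgeMap
        (((𝒢.galoisLevelData h37.toProp36Hypotheses).tree k).edgeOf β₁) =
      ((𝒢.galoisLevelData h37.toProp36Hypotheses).treeProj k).edgeMap
        (((𝒢.galoisLevelData h37.toProp36Hypotheses).tree k).edgeOf β₂) := by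
  classical
  let D := 𝒢.galoisLevelData h37.toProp36Hypotheses
  -- the first branch-point `β₀` of `p` (node 1)
  have hlen : 0 < p.length := by
    by_contra h
    obtain ⟨m, hm, hml⟩ := SimpleGraph.Walk.mem_support_iff_exists_getVert.mp hβ₁
    rw [show m = 0 by omega, SimpleGraph.Walk.getVert_zero] at hm
    simp at hm
  have hadj₀ := p.adj_getVert_succ (i := 0) hlen
  rw [SimpleGraph.Walk.getVert_zero, Nat.zero_add] at hadj₀
  obtain ⟨β₀, -, hβ₀⟩ := ((D.tree k).subdivision_adj_inl_iff (x k) _).mp hadj₀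
  -- every branch-point of `p` lies over the base edge of `β₀`
  have key : ∀ (j : ℕ) (b : (D.tree k).Branch), p.getVert j = Sum.inr (Sum.inr b) →
      (D.treeProj k).edgeMap ((D.tree k).edgeOf b) = (D.treeProj k).edgeMap ((D.tree k).edgeOf β₀) := by
    intro j
    induction j using Nat.strong_induction_on with
    | _ j ih =>
    intro b hb
    rcases j with _ | j
    · rw [SimpleGraph.Walk.getVert_zero] at hb
      simp at hb
    rcases j with _ | j
    · rw [Nat.zero_add, hβ₀] at hb
      have : β₀ = b := by simpa using hb
      rw [this]
    -- node `j + 2` is the branch-point `b`; look at nodes `j + 1` and `j`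
    have hlt : j + 1 < p.length := by
      by_contra h
      have h1 : p.getVert (j + 1 + 1) = Sum.inl (x' k) := p.getVert_of_length_le (by omega)
      rw [hb] at h1
      simp at h1
    have a₂ := p.adj_getVert_succ (i := j + 1) hlt
    rw [hb] at a₂
    have a₁ := p.adj_getVert_succ (i := j) (by omega)
    rcases ((D.tree k).subdivision_adj_branch_iff b _).mp a₂.symm with h | ⟨v, -, h⟩
    · -- through the edge-point of `b`: node `j` is a branch of the same edge
      rw [h] at a₁
      obtain ⟨b'', hb''e, hb''⟩ := ((D.tree k).subdivision_adj_edge_iff _ _).mp a₁.symm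
      rw [← ih j (by omega) b'' hb'', hb''e]
    · -- through a vertex-point: node `j` is a branch at that vertex, over the same base branch
      rw [h] at a₁
      obtain ⟨b'', -, hb''⟩ := ((D.tree k).subdivision_adj_inl_iff v _).mp a₁.symm
      have hbr := 𝒢.branchMap_eq_of_flanking_of_topCyclic h37 hcyc C hC x x' hx hx' hfx hfx' k p hp
        (i := j) hb'' h (by rw [show j + 2 = j + 1 + 1 by omega]; exact hb)
      rw [← ih j (by omega) b'' hb'', ← (D.treeProj k).edgeOf_branchMap b, ← hbr,
        (D.treeProj k).edgeOf_branchMap b'']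
  obtain ⟨i₁, hi₁, -⟩ := SimpleGraph.Walk.mem_support_iff_exists_getVert.mp hβ₁
  obtain ⟨i₂, hi₂, -⟩ := SimpleGraph.Walk.mem_support_iff_exists_getVert.mp hβ₂
  rw [key i₁ β₁ hi₁, key i₂ β₂ hi₂]

end TopCyclic

end ProfiniteSemiGraph

end Literature.AnabelianGeometry.SemiGraphs
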